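import Mathlib
import Literature.Computability.MetaComplexity.GapMKtPLightConeLowerBound
import Literature.Computability.MetaComplexity.OliveiraPichSanthanam2019.GapMKtPBranchingPrograms
import Literature.Computability.MetaComplexity.OliveiraSanthanam2018.ApproxMCSPJuntaBounds
import Literature.Computability.MetaComplexity.ZeroErrorMCSPLightConeLowerBound
import HarnessLib

/-!
# `Gap-MKtP[2^{βn}, 2^{βn}+cn]` versus `B₂`-formulas and branching programs of sub-linear size —
# the KNOWN column of census rows R17 / R18 (Oliveira–Pich–Santhanam 2021, Thm. 1.1 items 5 / 7)
# in the tree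

Folklore, fully proved (no named facts).  Oliveira–Pich–Santhanam, *Hardness magnification near
state-of-the-art lower bounds* (Theory of Computing 17(11), 2021), Thm. 1.1 items 5 and 7 (tree:
`OliveiraPichSanthanam2019.thm11_item5`, `thm11_item7`; census rows R17, R18, `gap_R17` / `gap_R18` of
`MagnificationGapCensus.lean`) magnify the hypotheses `Gap-MKtP[2^{βn}, 2^{βn}+cn] ∉
B₂-Formula[N^{2+ε}]` (`GapMKtPB2FormulaLB U c (2+ε) β`, class `B2FORMULAae`) and `∉ BP[N^{2+ε}]`
(`GapMKtPBPLB U c (2+ε) β`, class `BPSIZEae`), for all small `β`, to `EXP ⊄ Formula[poly]` /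
`EXP ⊄ BP[poly]`.  The census records for both rows "PARAM-MISMATCH": print's only same-model bounds
(Thm. 1.2 items 2 / 3, `N^{2-ε}`) are at the large parameters `Gap-MKtP[2^{(1-δ)n}, 2^{n-1}]`, and
at the magnification thresholds no `B₂`-formula or branching-program bound is stated (Thm. 1.3 is
for `U₂`-formulas, row R16).  This file PROVES the folklore junta / light-cone bound for
`Gap-MKtP[2^{βn}, 2^{βn}+cn]` IN THE ROWS' OWN MODELS (the predicates `GapMKtPB2FormulaLB`,
`GapMKtPBPLB` themselves, at exponents `κ < 1`), completing for formulas and branching programs what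
`GapMKtPLightConeLowerBound.lean` did for general circuits (rows R19 / R23,
`gapMKtPCircuitLB_of_neg`):

* **Branching programs are juntas** (`BPFamily.Decides.eval_ofFn`,
  `not_mem_promiseLift_BPSIZEae_of_frequently`): a deterministic branching program with `k`
  inner nodes queries `≤ k` variables (`ChenJinWilliams2020.bp_eval_congr`), so if infinitely often a
  promise problem has a YES instance of length `n` and `< 2^{n-k(n)}` non-NO strings of length `n`,
  no language consistent with it lies in `BPSIZEae k` — the `BPSIZEae` twin of
  `OliveiraSanthanam2018.not_mem_promiseLift_FamilyAE_of_frequently` (circuit families with small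
  light cones; its `B₂`-formula instance is `not_mem_promiseLift_B2FORMULAae_of_frequently`, via
  `ChenJinWilliams2020.card_lightCone_le_leafSize`).
* **`Gap-MKtP`** (`gapMKtP_not_mem_promiseLift_B2FORMULAae`, `gapMKtP_not_mem_promiseLift_BPSIZEae`,
  from the counting of `GapMKtPLightConeLowerBound.lean`: `< 2^{s₂(N)+1}` strings of length `N` have
  `Kt ≤ s₂(N)`, `UniversalMachine.ncard_not_mem_gapMKtP_no_lt`, and `1^N` is a YES instance of
  `Gap-MKtP[N^β, ·]` at every large `N`): `Gap-MKtP[s₁, s₂] ∉ promiseLift (B2FORMULAae s)` and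
  `∉ promiseLift (BPSIZEae s)` as soon as, infinitely often, a YES instance exists and
  `s₂ N + s N + 1 ≤ N`; at the OPS thresholds (`_sublinear`): `∉ promiseLift (B2FORMULAae (N ↦
  N − ⌈N^{β'}⌉))`, `∉ promiseLift (BPSIZEae (N ↦ N − ⌈N^{β'}⌉))` for `0 < β < β' < 1`
  (`eventually_powLogThreshold_add_le`).
* **Rows R17 / R18, KNOWN** (`gapMKtPB2FormulaLB_of_lt_one`, `gapMKtPBPLB_of_lt_one` and their
  `∀ β` forms): for every `U`, `c`, every `β ∈ (0, 1)` and EVERY `κ < 1`,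
  `GapMKtPB2FormulaLB U c κ β` and `GapMKtPBPLB U c κ β` hold outright — the rows' hypothesis
  predicates with the exponent `2 + ε` replaced by any `κ < 1`.  NEEDED (rows R17 / R18,
  `MKtPB2FormulaHypothesis` / `MKtPBPHypothesis`): some `ε > 0` with the predicate at `κ = 2 + ε`
  for all small `β`.  Same-model gap: exponent `1⁻` known versus `2 + ε` needed (the open part is
  the exponent interval `[1, 2+ε]`; compare row R16, where print's Thm. 1.3 gives every `κ < 2` for
  `U₂`-formulas against `3 + ε` needed).
* **Decision versions** (`UniversalMachine.gapMKtP_mem_promiseLift_of_MKtP_mem`,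
  `MKtP_powLogThreshold_not_mem_B2FORMULAae_sublinear`,
  `MKtP_powLogThreshold_not_mem_BPSIZEae_sublinear`, `MKtP_powLogThreshold_not_mem_powSize`): the
  language `MKtP[⌊N^β + c·log₂ N⌋]` separates the promise problem, so it lies outside the same
  classes.
* **No ceiling statement** is recorded for these rows: unlike the `MCSP` rows (census parts XXV,
  XXVIII, XXX), `Kt` is not witnessed by agreement on a few coordinates, so the file does not claim
  that juntas decide `Gap-MKtP`; the cells use the device solely through the number of variables it
  reads, as every light-cone cell of the census.

References: I. C. Oliveira, J. Pich, R. Santhanam, *Hardness magnification near state-of-the-art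
lower bounds*, Theory of Computing 17(11):1–38, 2021 (CCC 2019), Thm. 1.1 items 5, 7, Thm. 1.2,
§1.2 (models) [key OliveiraPichSanthanam2021]; I. Wegener, *Branching Programs and Binary Decision
Diagrams* (2000), Def. 1.1.1 [key Wegener2000]; S. Jukna, *Boolean Function Complexity* (2012),
§1.4 (counting) [key Jukna2012].
-/

open Finset Filter Topology

namespace Literature.Computability.MetaComplexity.OliveiraPichSanthanam2019

open Literature.Computability.Complexity Literature.Computability.Complexity.Circuit
open Literature.Computability.MetaComplexity
open Literature.Computability.MetaComplexity.ChenJinWilliams2020 (bp_eval_congr card_lightCone_le_leafSize)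
open scoped Classical

/-! ### Branching-program families versus juntas -/

/-- Vector form of `BPFamily.Decides`: the program at length `n` computes the indicator of `L` on
`List.ofFn u`. [folklore] -/
theorem _root_.Literature.Computability.MetaComplexity.BPFamily.Decides.eval_ofFn {B : BPFamily}
    {L : Language Bool} (h : B.Decides L) {n : ℕ} (u : Fin n → Bool) :
    (B n).eval u = L.boolIndicator (List.ofFn u) := by
  have key : ∀ (z : List Bool) (M : ℕ) (hz : z.length = M),
      (B M).eval (fun i => z.get (i.cast hz.symm)) = (B z.length).eval z.get := by
    rintro z _ rfl
    rfl
  have hk := key (List.ofFn u) n (List.length_ofFn ..)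
  have hu : (fun i : Fin n => (List.ofFn u).get (i.cast (List.length_ofFn ..).symm)) = u := by
    funext i
    simp
  rw [hu] at hk
  rw [hk]
  exact h (List.ofFn u)

/-- **A.e. families of small branching programs do not decide a sparse-complement promise
problem.** A deterministic branching program with `≤ k(n)` inner nodes queries at most `k(n)`
variables (`bp_eval_congr`); if infinitely often `P` has a YES instance of length `n` but fewer than
`2^{n - k(n)}` non-NO strings of length `n`, then no language consistent with `P` lies in
`BPSIZEae k`. [folklore] -/
theorem not_mem_promiseLift_BPSIZEae_of_frequently {P : PromiseProblem} {k : ℕ → ℕ}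
    (h : ∃ᶠ n : ℕ in atTop, (∃ y : Fin n → Bool, List.ofFn y ∈ P.yes) ∧
      #{z : Fin n → Bool | List.ofFn z ∉ P.no} < 2 ^ (n - k n)) :
    P ∉ promiseLift (BPSIZEae k) := by
  rintro ⟨L, ⟨B, ⟨n₀, hB⟩, hdec⟩, hyes, hno⟩
  obtain ⟨n, hn₀, ⟨y, hy⟩, hlt⟩ := frequently_atTop.1 h n₀
  -- the variables queried by the program at length `n`
  set S : Finset (Fin n) := univ.image (B n).var with hSdef
  have hS : S.card ≤ k n :=
    card_image_le.trans (by simpa [BranchingProgram.size] using hB n hn₀)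
  have hBy : (B n).eval y = true := by
    rw [hdec.eval_ofFn]
    exact (Set.mem_iff_boolIndicator _ _).1 (hyes hy)
  -- every input agreeing with `y` on `S` is accepted, hence not a NO instance
  have h1 : 2 ^ (n - k n) ≤ #{x : Fin n → Bool | ∀ i ∈ S, x i = y i} :=
    calc 2 ^ (n - k n) ≤ 2 ^ (Fintype.card (Fin n) - S.card) :=
          Nat.pow_le_pow_right (by norm_num) (by simp only [Fintype.card_fin]; omega)
      _ ≤ _ := by convert two_pow_le_card_filter_agree S y
  have h2 : #{x : Fin n → Bool | ∀ i ∈ S, x i = y i} ≤ #{z : Fin n → Bool | List.ofFn z ∉ P.no} := by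
    refine card_le_card fun x hx => ?_
    simp only [mem_filter, mem_univ, true_and] at hx ⊢
    intro hxno
    have hBx : (B n).eval x = false := by
      rw [hdec.eval_ofFn]
      exact (Set.notMem_iff_boolIndicator _ _).1 (hno hxno)
    have hxy : (B n).eval x = (B n).eval y :=
      bp_eval_congr (B n) fun v => hx _ (by rw [hSdef]; exact mem_image_of_mem _ (mem_univ v))
    rw [hBx, hBy] at hxy
    exact Bool.false_ne_true hxy
  exact absurd (h1.trans h2) (not_le.2 hlt)

/-- **`B₂`-formulas of leaf size `t(n)` are `t(n)`-juntas** (`card_lightCone_le_leafSize`): the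
`B2FORMULAae` instance of `OliveiraSanthanam2018.not_mem_promiseLift_FamilyAE_of_frequently`.
[folklore] -/
theorem not_mem_promiseLift_B2FORMULAae_of_frequently {P : PromiseProblem} {t : ℕ → ℕ}
    (h : ∃ᶠ n : ℕ in atTop, (∃ y : Fin n → Bool, List.ofFn y ∈ P.yes) ∧
      #{z : Fin n → Bool | List.ofFn z ∉ P.no} < 2 ^ (n - t n)) :
    P ∉ promiseLift (B2FORMULAae t) :=
  OliveiraSanthanam2018.not_mem_promiseLift_FamilyAE_of_frequently
    (fun _ C hC => (card_lightCone_le_leafSize C).trans hC.2.2) h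

/-! ### `Gap-MKtP[s₁, s₂]` against `B₂`-formulas and branching programs -/

/-- The vector-form counting hypothesis for `Gap-MKtP[s₁, s₂]` at a length `N` with a YES instance
and `s₂ N + s N + 1 ≤ N`: a YES vector exists and fewer than `2^{N - s N}` vectors are non-NO
(`UniversalMachine.ncard_not_mem_gapMKtP_no_lt`: `< 2^{s₂ N + 1}` strings have `Kt ≤ s₂ N`).
[folklore] -/
theorem gapMKtP_count (U : UniversalMachine) (s₁ s₂ s : ℕ → ℕ) {N : ℕ}
    (hy : ∃ y : List Bool, y.length = N ∧ U.levinKt y ≤ s₁ N) (hN : s₂ N + s N + 1 ≤ N) :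
    (∃ y : Fin N → Bool, List.ofFn y ∈ (U.gapMKtP s₁ s₂).yes) ∧
      #{z : Fin N → Bool | List.ofFn z ∉ (U.gapMKtP s₁ s₂).no} < 2 ^ (N - s N) := by
  obtain ⟨y, hyN, hy⟩ := hy
  subst hyN
  refine ⟨⟨y.get, ?_⟩, ?_⟩
  · rw [List.ofFn_get]
    exact hy
  · have hset : ({x : Fin y.length → Bool | List.ofFn x ∉ (U.gapMKtP s₁ s₂).no} : Set _) =
        ↑(univ.filter fun x : Fin y.length → Bool => List.ofFn x ∉ (U.gapMKtP s₁ s₂).no) := by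
      ext x; simp
    have hlt := U.ncard_not_mem_gapMKtP_no_lt s₁ s₂ y.length
    rw [hset, Set.ncard_coe_finset] at hlt
    exact hlt.trans_le (Nat.pow_le_pow_right (by norm_num) (by omega))

/-- **`Gap-MKtP[s₁, s₂]` against `B₂`-formulas (family form).** If at infinitely many lengths `N`
some string of length `N` has `Kt ≤ s₁ N` and `s₂ N + s N + 1 ≤ N`, then
`Gap-MKtP[s₁, s₂] ∉ promiseLift (B2FORMULAae s)`. [folklore] -/
theorem gapMKtP_not_mem_promiseLift_B2FORMULAae (U : UniversalMachine) {s₁ s₂ s : ℕ → ℕ}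
    (h : ∃ᶠ N : ℕ in atTop, (∃ y : List Bool, y.length = N ∧ U.levinKt y ≤ s₁ N) ∧
      s₂ N + s N + 1 ≤ N) :
    U.gapMKtP s₁ s₂ ∉ promiseLift (B2FORMULAae s) :=
  not_mem_promiseLift_B2FORMULAae_of_frequently
    (h.mono fun _ hN => gapMKtP_count U s₁ s₂ s hN.1 hN.2)

/-- **`Gap-MKtP[s₁, s₂]` against deterministic branching programs (family form).** Same hypothesis;
conclusion `Gap-MKtP[s₁, s₂] ∉ promiseLift (BPSIZEae s)`. [folklore] -/
theorem gapMKtP_not_mem_promiseLift_BPSIZEae (U : UniversalMachine) {s₁ s₂ s : ℕ → ℕ}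
    (h : ∃ᶠ N : ℕ in atTop, (∃ y : List Bool, y.length = N ∧ U.levinKt y ≤ s₁ N) ∧
      s₂ N + s N + 1 ≤ N) :
    U.gapMKtP s₁ s₂ ∉ promiseLift (BPSIZEae s) :=
  not_mem_promiseLift_BPSIZEae_of_frequently
    (h.mono fun _ hN => gapMKtP_count U s₁ s₂ s hN.1 hN.2)

/-- The OPS-threshold hypothesis holds eventually: `1^N` is a YES instance of `Gap-MKtP[N^β, ·]`
at every large `N` and `⌊N^β + c·log₂ N⌋ + (N - ⌈N^{β'}⌉) + 1 ≤ N` for `0 < β < β' < 1`.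
[folklore] -/
theorem frequently_gapMKtP_threshold_hypothesis (U : UniversalMachine) (c : ℕ) {β β' : ℝ}
    (hβ : 0 < β) (hββ' : β < β') (hβ'1 : β' < 1) :
    ∃ᶠ N : ℕ in atTop, (∃ y : List Bool, y.length = N ∧
        U.levinKt y ≤ UniversalMachine.powThreshold β N) ∧
      UniversalMachine.powLogThreshold β c N + (N - ⌈(N : ℝ) ^ β'⌉₊) + 1 ≤ N := by
  have hyes : ∀ᶠ N : ℕ in atTop, ∃ y : List Bool, y.length = N ∧
      U.levinKt y ≤ UniversalMachine.powThreshold β N := by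
    obtain ⟨N₀, hN₀⟩ :=
      U.eventually_ones_mem_gapMKtP_yes_powThreshold hβ (UniversalMachine.powLogThreshold β c)
    refine eventually_atTop.2 ⟨N₀, fun N hN => ⟨ones N, by simp, ?_⟩⟩
    have h : U.levinKt (ones N) ≤ (UniversalMachine.powThreshold β (ones N).length : ℕ) := hN₀ N hN
    simpa using h
  refine Eventually.frequently (hyes.and ((eventually_powLogThreshold_add_le hββ' (hβ.trans hββ')
    hβ'1.le c).mono fun N hN => ?_))
  omega

/-- **Rows R17, KNOWN (class form)**: `Gap-MKtP[⌊N^β⌋, ⌊N^β + c·log₂ N⌋] ∉ promiseLift (B2FORMULAae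
(N ↦ N − ⌈N^{β'}⌉))` for `0 < β < β' < 1` — no language consistent with the promise has a.e.
`B₂`-formulas of leaf size `N − ⌈N^{β'}⌉`. [folklore] -/
theorem gapMKtP_not_mem_B2FORMULAae_sublinear (U : UniversalMachine) (c : ℕ) {β β' : ℝ}
    (hβ : 0 < β) (hββ' : β < β') (hβ'1 : β' < 1) :
    U.gapMKtP (UniversalMachine.powThreshold β) (UniversalMachine.powLogThreshold β c) ∉
      promiseLift (B2FORMULAae fun N => N - ⌈(N : ℝ) ^ β'⌉₊) :=
  gapMKtP_not_mem_promiseLift_B2FORMULAae U (frequently_gapMKtP_threshold_hypothesis U c hβ hββ' hβ'1)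

/-- **Row R18, KNOWN (class form)**: `Gap-MKtP[⌊N^β⌋, ⌊N^β + c·log₂ N⌋] ∉ promiseLift (BPSIZEae
(N ↦ N − ⌈N^{β'}⌉))` for `0 < β < β' < 1`. [folklore] -/
theorem gapMKtP_not_mem_BPSIZEae_sublinear (U : UniversalMachine) (c : ℕ) {β β' : ℝ}
    (hβ : 0 < β) (hββ' : β < β') (hβ'1 : β' < 1) :
    U.gapMKtP (UniversalMachine.powThreshold β) (UniversalMachine.powLogThreshold β c) ∉
      promiseLift (BPSIZEae fun N => N - ⌈(N : ℝ) ^ β'⌉₊) :=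
  gapMKtP_not_mem_promiseLift_BPSIZEae U (frequently_gapMKtP_threshold_hypothesis U c hβ hββ' hβ'1)

/-! ### Rows R17 / R18 in the vocabulary of OPS Theorem 1.1 items 5 / 7 -/

/-- An exponent strictly between `max β κ` and `1`. [folklore] -/
theorem exists_exponent_between {β κ : ℝ} (hβ1 : β < 1) (hκ : κ < 1) :
    ∃ β' : ℝ, β < β' ∧ κ < β' ∧ β' < 1 :=
  ⟨(max β κ + 1) / 2, by have := le_max_left β κ; linarith,
    by have := le_max_right β κ; linarith, by have := max_lt hβ1 hκ; linarith⟩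

/-- **Row R17, KNOWN column, in the vocabulary of OPS Theorem 1.1 item 5.** For every `U`, `c`,
`β ∈ (0, 1)` and EVERY `κ < 1`: `GapMKtPB2FormulaLB U c κ β` (`Gap-MKtP[2^{βn}, 2^{βn}+cn] ∉
B₂-Formula[N^κ]`), unconditionally; the row NEEDS `κ = 2 + ε` for some `ε > 0`
(`MKtPB2FormulaHypothesis U c`). The same-model gap is the exponent: `1⁻` proved versus `2 + ε`
needed; print's `N^{2-ε}` (Thm. 1.2 item 2) is at other parameters.
[cite: OliveiraPichSanthanam2021, Thm. 1.1 item 5 (hypothesis shape; folklore known bound)] -/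
theorem gapMKtPB2FormulaLB_of_lt_one (U : UniversalMachine) (c : ℕ) {κ β : ℝ} (hκ : κ < 1)
    (hβ : 0 < β) (hβ1 : β < 1) : GapMKtPB2FormulaLB U c κ β := by
  obtain ⟨β', hββ', hκβ', hβ'1⟩ := exists_exponent_between hβ1 hκ
  intro hmem
  exact gapMKtP_not_mem_B2FORMULAae_sublinear U c hβ hββ' hβ'1
    (promiseLift_mono (B2FORMULAae_mono (eventually_powSize_le_sub_ceil hκβ' (hβ.trans hββ') hβ'1))
      hmem)

/-- **Row R18, KNOWN column, in the vocabulary of OPS Theorem 1.1 item 7.** For every `U`, `c`,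
`β ∈ (0, 1)` and EVERY `κ < 1`: `GapMKtPBPLB U c κ β` (`Gap-MKtP[2^{βn}, 2^{βn}+cn] ∉ BP[N^κ]`),
unconditionally; the row NEEDS `κ = 2 + ε` for some `ε > 0` (`MKtPBPHypothesis U c`); print's
`N^{2-ε}` (Thm. 1.2 item 3) and Cheraghchi et al.'s `Ω(N²/log² N)` are at other parameters.
[cite: OliveiraPichSanthanam2021, Thm. 1.1 item 7 (hypothesis shape; folklore known bound)] -/
theorem gapMKtPBPLB_of_lt_one (U : UniversalMachine) (c : ℕ) {κ β : ℝ} (hκ : κ < 1)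
    (hβ : 0 < β) (hβ1 : β < 1) : GapMKtPBPLB U c κ β := by
  obtain ⟨β', hββ', hκβ', hβ'1⟩ := exists_exponent_between hβ1 hκ
  intro hmem
  exact gapMKtP_not_mem_BPSIZEae_sublinear U c hβ hββ' hβ'1
    (promiseLift_mono (BPSIZEae_mono (eventually_powSize_le_sub_ceil hκβ' (hβ.trans hββ') hβ'1))
      hmem)

/-- The `∃ β₀ ∀ β < β₀` form matching the rows' quantifier shape (`β₀ = 1`): for every `κ < 1`,
`∃ β₀ > 0, ∀ β ∈ (0, β₀), GapMKtPB2FormulaLB U c κ β ∧ GapMKtPBPLB U c κ β` — i.e.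
`MKtPB2FormulaHypothesis U c` / `MKtPBPHypothesis U c` with `2 + ε` replaced by any `κ < 1` hold
outright. [cite: OliveiraPichSanthanam2021, Thm. 1.1 items 5, 7 (hypothesis shape; folklore known bound)] -/
theorem gapMKtP_formula_bp_known_forall (U : UniversalMachine) (c : ℕ) {κ : ℝ} (hκ : κ < 1) :
    ∃ β₀ : ℝ, 0 < β₀ ∧ ∀ β : ℝ, 0 < β → β < β₀ →
      GapMKtPB2FormulaLB U c κ β ∧ GapMKtPBPLB U c κ β :=
  ⟨1, one_pos, fun _ hβ hβ1 =>
    ⟨gapMKtPB2FormulaLB_of_lt_one U c hκ hβ hβ1, gapMKtPBPLB_of_lt_one U c hκ hβ hβ1⟩⟩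

/-! ### Decision versions: the language `MKtP[⌊N^β + c·log₂ N⌋]` -/

/-- The language `MKtP[s₂]` is consistent with the promise problem `Gap-MKtP[s₁, s₂]` whenever
`s₁ ≤ s₂` pointwise; so a class containing `MKtP[s₂]` has `Gap-MKtP[s₁, s₂]` in its promise lift.
[folklore] -/
theorem _root_.Literature.Computability.MetaComplexity.UniversalMachine.gapMKtP_mem_promiseLift_of_MKtP_mem
    (U : UniversalMachine) {s₁ s₂ : ℕ → ℕ} (h12 : ∀ N, s₁ N ≤ s₂ N) {C : Set (Language Bool)}
    (hmem : U.MKtP s₂ ∈ C) : U.gapMKtP s₁ s₂ ∈ promiseLift C := by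
  refine ⟨U.MKtP s₂, hmem, fun x hx => ?_, fun x hx hxL => ?_⟩
  · exact le_trans (show U.levinKt x ≤ (s₁ x.length : ℕ) from hx) (by exact_mod_cast h12 x.length)
  · exact absurd (lt_of_lt_of_le ((U.mem_gapMKtP_no_iff).1 hx) hxL) (lt_irrefl _)

/-- **Decision version, `B₂`-formulas**: `MKtP[⌊N^β + c·log₂ N⌋] ∉ B2FORMULAae (N − ⌈N^{β'}⌉)` for
`0 < β < β' < 1` (the `B₂`-formula twin of `MKtP_powLogThreshold_not_mem_SIZEae_sublinear`).
[folklore] -/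
theorem MKtP_powLogThreshold_not_mem_B2FORMULAae_sublinear (U : UniversalMachine) (c : ℕ)
    {β β' : ℝ} (hβ : 0 < β) (hββ' : β < β') (hβ'1 : β' < 1) :
    U.MKtP (UniversalMachine.powLogThreshold β c) ∉ B2FORMULAae fun N => N - ⌈(N : ℝ) ^ β'⌉₊ :=
  fun hmem => gapMKtP_not_mem_B2FORMULAae_sublinear U c hβ hββ' hβ'1
    (U.gapMKtP_mem_promiseLift_of_MKtP_mem (fun N => powThreshold_le_powLogThreshold β c N) hmem)

/-- **Decision version, branching programs**: `MKtP[⌊N^β + c·log₂ N⌋] ∉ BPSIZEae (N − ⌈N^{β'}⌉)`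
for `0 < β < β' < 1`. [folklore] -/
theorem MKtP_powLogThreshold_not_mem_BPSIZEae_sublinear (U : UniversalMachine) (c : ℕ)
    {β β' : ℝ} (hβ : 0 < β) (hββ' : β < β') (hβ'1 : β' < 1) :
    U.MKtP (UniversalMachine.powLogThreshold β c) ∉ BPSIZEae fun N => N - ⌈(N : ℝ) ^ β'⌉₊ :=
  fun hmem => gapMKtP_not_mem_BPSIZEae_sublinear U c hβ hββ' hβ'1
    (U.gapMKtP_mem_promiseLift_of_MKtP_mem (fun N => powThreshold_le_powLogThreshold β c N) hmem)

/-- **Decision versions in exponent form**: for every `κ < 1` and `β ∈ (0, 1)`, the language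
`MKtP[⌊N^β + c·log₂ N⌋]` has neither a.e. `B₂`-formulas of leaf size `⌊N^κ⌋` nor a.e. branching
programs of size `⌊N^κ⌋`. [folklore] -/
theorem MKtP_powLogThreshold_not_mem_powSize (U : UniversalMachine) (c : ℕ) {κ β : ℝ}
    (hκ : κ < 1) (hβ : 0 < β) (hβ1 : β < 1) :
    U.MKtP (UniversalMachine.powLogThreshold β c) ∉ B2FORMULAae (powSize κ) ∧
      U.MKtP (UniversalMachine.powLogThreshold β c) ∉ BPSIZEae (powSize κ) :=
  ⟨fun hmem => gapMKtPB2FormulaLB_of_lt_one U c hκ hβ hβ1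
      (U.gapMKtP_mem_promiseLift_of_MKtP_mem (fun N => powThreshold_le_powLogThreshold β c N) hmem),
    fun hmem => gapMKtPBPLB_of_lt_one U c hκ hβ hβ1
      (U.gapMKtP_mem_promiseLift_of_MKtP_mem (fun N => powThreshold_le_powLogThreshold β c N) hmem)⟩

end Literature.Computability.MetaComplexity.OliveiraPichSanthanam2019
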